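import Summits.ValiantsHypothesis.ValiantsHypothesis.Theorems.LacunarySymmetroidMatrixDescartesCensusAltChainLift
import Summits.ValiantsHypothesis.ValiantsHypothesis.Theorems.LacunarySymmetroidMatrixDescartesCensusDefs

/-!
# `MatrixDescartes` census — DOOR A at `(3,4)`: the NULL-END LIFT (a null-bottom chain-eighteen lifts to a nineteen)

HONEST FRAMING.  Object-search cell `pub-symmetroid`, route `LacunarySymmetroid`; this file sits beside ONE typed statement,
the route item `Theses.LacunarySymmetroid.DoorA34` (stmt-ValiantsHypothesis-19980, `= DoorA34 = PosRootLawAt 3 4 18`), which is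
OPEN and asserted nowhere.  It proves, ONCE FOR ALL SUPPORTS, the second boundary perturbation statement of the `V = 19` cell
(companion of `…CensusDoorA34Lift`, the A′ bridge) — the `(3,4)` counterpart of the `(2,6)` file `…CensusBoundaryLift`:

* `det_add_smul_vecMulVec_fin_three` — rank-one determinant lemma `det (M + c·kkᵀ) = det M + c·kᵀ adj(M) k` (`3 × 3`, any
  commutative ring: NO `c²`, `c³` terms); `det_pencil_perturb_rankOne` — its pencil form: perturbing the bottom letter by
  `η·kkᵀ` changes the pencil determinant by `η·X^{d₀}·(kᵀ adj(F) k)`.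
* `pencil_eq_X_pow_smul`, `eval_zero_reduced_pencil` — `F = X^{d₀} • N` with `N(0) = S₀` when `d₀ < d_l` (`l ≠ 0`), so that
  every coefficient fact needed is an EVALUATION AT ZERO (`det` and `adj` commute with ring homomorphisms): `det F = X^{3d₀} det N`
  with `(det N)(0) = det S₀`, and `kᵀ adj(F) k = X^{2d₀} q₁` with `q₁(0) = kᵀ adj(S₀) k`.
* `nineteen_of_nullBottom_eighteen` — **NULL-END LIFT at `(3,4)`**: if the bottom letter is singular of adjugate rank
  (`det S₀ = 0`, `kᵀ adj(S₀) k ≠ 0`), `d₀ < d_l` (`l ≠ 0`), and `det` carries an ALTERNATION CHAIN of `N + 1` positive points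
  (`AltChain`, `…CensusAltChainLift`), then `S₀ ↦ S₀ + η kkᵀ` (small `η` of the right sign; same support, still symmetric —
  `perturb_rankOne_isSymm`) yields `≥ N + 1` distinct positive det-roots: the chain is kept and the new bottom monomial
  `η kᵀadj(S₀)k · X^{3d₀}` adds one alternation point near `0` (`altChain_lift_step`).  With `N = 18`: a NULL-BOTTOM
  EIGHTEEN LIFTS TO A NINETEEN.  The top-end version (`det S₃ = 0`) is this statement on the mirror support
  (`Census.posRootLawOn_iff_mirror_rev`).
* `no_nullBottom_eighteen_of_posRootLawOn` — contrapositive in row currency: a kernel proof of `PosRootLawOn 3 4 18 d`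
  excludes null-bottom chain-eighteens on `d`.

NOTHING here asserts that such boundary objects exist or do not exist; nothing bounds `ζ_sym(3,4)`; `DoorA34` stays OPEN;
nothing bears on `MatrixDescartes` (stmt-ValiantsHypothesis-18050) or on `VP ≠ VNP`.

[folklore] Matrix determinant lemma; intermediate values near `0`; no citation is needed.
-/

-- `Summit.ValiantsHypothesis.ValiantsHypothesis.…` repeats a component by the D-0017 layout
-- (single-conjunct summit), which the `dupNamespace` linter flags; the name is mandated.
set_option linter.dupNamespace false

namespace Summit.ValiantsHypothesis.ValiantsHypothesis.Theorems.LacunarySymmetroidMatrixDescartes.Census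

open Polynomial Finset
open scoped BigOperators Polynomial Matrix
open Summit.ValiantsHypothesis.ValiantsHypothesis.Theorems.MatrixDescartes.Negative (PosRootLawAt)

/-- **Rank-one determinant lemma (`3 × 3`, any commutative ring)**: `det (M + c·kkᵀ) = det M + c·(kᵀ adj(M) k)` — no
`c²`, `c³` terms. [folklore] -/
theorem det_add_smul_vecMulVec_fin_three {R : Type*} [CommRing R] (M : Matrix (Fin 3) (Fin 3) R) (c : R)
    (k : Fin 3 → R) :
    (M + c • Matrix.vecMulVec k k).det = M.det + c * (k ⬝ᵥ (M.adjugate *ᵥ k)) := by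
  simp only [Matrix.det_fin_three, Matrix.adjugate_fin_three, Matrix.add_apply, Matrix.vecMulVec_apply,
    Matrix.smul_apply, smul_eq_mul, Matrix.mulVec, dotProduct, Fin.sum_univ_three, Matrix.of_apply,
    Matrix.cons_val', Matrix.cons_val_zero, Matrix.cons_val_one, Matrix.head_cons, Matrix.cons_val_two,
    Matrix.tail_cons, Matrix.empty_val', Matrix.cons_val_fin_one, Matrix.head_fin_const]
  ring

/-! ## The null-end lift at `(3,4)`: a null-bottom chain-eighteen lifts to a nineteen on the same support -/

/-- **Pencil form of the rank-one determinant lemma.**  Perturbing the bottom letter by `η·kkᵀ` changes the pencil determinant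
by `η · X^{d 0} · (kᵀ adj(F) k)` (as polynomials). [folklore] -/
theorem det_pencil_perturb_rankOne (d : Fin 4 → ℕ) (S : Fin 4 → Matrix (Fin 3) (Fin 3) ℝ) (k : Fin 3 → ℝ) (η : ℝ) :
    ((∑ l, (X : ℝ[X]) ^ d l • ((S l + if l = 0 then η • Matrix.vecMulVec k k else 0)).map C)).det
      = ((∑ l, (X : ℝ[X]) ^ d l • (S l).map C)).det
        + C η * (X ^ d 0 * ((fun i => C (k i)) ⬝ᵥ ((∑ l, (X : ℝ[X]) ^ d l • (S l).map C).adjugate *ᵥ (fun i => C (k i))))) := by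
  have hsplit : (∑ l, (X : ℝ[X]) ^ d l • ((S l + if l = 0 then η • Matrix.vecMulVec k k else 0)).map C)
      = (∑ l, (X : ℝ[X]) ^ d l • (S l).map C) + (C η * X ^ d 0) • Matrix.vecMulVec (fun i => C (k i)) (fun i => C (k i)) := by
    have h : ∀ l : Fin 4, (X : ℝ[X]) ^ d l • ((S l + if l = 0 then η • Matrix.vecMulVec k k else 0)).map C
        = (X : ℝ[X]) ^ d l • (S l).map C
          + (if l = 0 then (X : ℝ[X]) ^ d l • ((η • Matrix.vecMulVec k k).map C) else 0) := by
      intro l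
      split_ifs
      · rw [Matrix.map_add, smul_add]
        exact fun a b => C_add
      · rw [add_zero, add_zero]
    simp_rw [h, Finset.sum_add_distrib, Finset.sum_ite_eq', Finset.mem_univ, if_true]
    congr 1
    ext i j
    simp only [Matrix.smul_apply, Matrix.map_apply, Matrix.vecMulVec_apply, smul_eq_mul, C_mul]
    ring
  rw [hsplit, det_add_smul_vecMulVec_fin_three]
  ring

/-- the pencil factors as `X^{d 0} • N` with `N = Σ_l X^{d l − d 0} • S l` when `d 0 ≤ d l`. [folklore] -/
theorem pencil_eq_X_pow_smul (d : Fin 4 → ℕ) (S : Fin 4 → Matrix (Fin 3) (Fin 3) ℝ) (h0 : ∀ l, d 0 ≤ d l) :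
    (∑ l, (X : ℝ[X]) ^ d l • (S l).map C) = (X : ℝ[X]) ^ d 0 • (∑ l, (X : ℝ[X]) ^ (d l - d 0) • (S l).map C) := by
  rw [Finset.smul_sum]
  refine Finset.sum_congr rfl fun l _ => ?_
  rw [smul_smul, ← pow_add, Nat.add_sub_cancel' (h0 l)]

/-- evaluating the reduced pencil `N` at `0` gives the bottom letter (when `d 0 < d l` for `l ≠ 0`). [folklore] -/
theorem eval_zero_reduced_pencil (d : Fin 4 → ℕ) (S : Fin 4 → Matrix (Fin 3) (Fin 3) ℝ) (h0 : ∀ l, l ≠ 0 → d 0 < d l) :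
    (Polynomial.evalRingHom 0).mapMatrix (∑ l, (X : ℝ[X]) ^ (d l - d 0) • (S l).map C) = S 0 := by
  rw [map_sum, Finset.sum_eq_single (0 : Fin 4)]
  · ext i j
    simp [Matrix.map_apply]
  · intro l _ hl
    have hpos : 0 < d l - d 0 := Nat.sub_pos_of_lt (h0 l hl)
    ext i j
    simp [Matrix.map_apply, zero_pow hpos.ne']
  · intro h; exact absurd (Finset.mem_univ _) h

/-- **NULL-END LIFT at `(3,4)` (bottom end).**  Let `d 0 < d l` for `l ≠ 0`, all `S l` real symmetric `3 × 3`, the bottom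
letter singular with `kᵀ adj(S 0) k ≠ 0` (rank exactly `2`, `k` off the adjugate's kernel), and let the pencil determinant carry
an alternation chain of `N + 1` positive points.  Then for some real `η` the symmetric pencil with bottom letter `S 0 + η·kkᵀ`
(same support) has at least `N + 1` distinct positive det-roots.  With `N = 18`: a NULL-BOTTOM EIGHTEEN LIFTS TO A NINETEEN.
[folklore] -/
theorem nineteen_of_nullBottom_eighteen (d : Fin 4 → ℕ) (h0 : ∀ l, l ≠ 0 → d 0 < d l)
    (S : Fin 4 → Matrix (Fin 3) (Fin 3) ℝ) (hdet : (S 0).det = 0)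
    (k : Fin 3 → ℝ) (hk : k ⬝ᵥ ((S 0).adjugate *ᵥ k) ≠ 0)
    {N : ℕ} {s : ℝ} {a : Fin (N + 1) → ℝ}
    (hchain : AltChain ((∑ l, (X : ℝ[X]) ^ d l • (S l).map C).det) N s a) :
    ∃ η : ℝ, N + 1 ≤ ((((∑ l, (X : ℝ[X]) ^ d l •
      ((S l + if l = 0 then η • Matrix.vecMulVec k k else 0)).map C)).det).roots.toFinset.filter (fun t => 0 < t)).card := by
  classical
  have h0' : ∀ l, d 0 ≤ d l := fun l => by
    by_cases hl : l = 0
    · rw [hl]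
    · exact (h0 l hl).le
  set P : Matrix (Fin 3) (Fin 3) ℝ[X] := ∑ l, (X : ℝ[X]) ^ d l • (S l).map C with hP
  set Nm : Matrix (Fin 3) (Fin 3) ℝ[X] := ∑ l, (X : ℝ[X]) ^ (d l - d 0) • (S l).map C with hNm
  have hPN : P = (X : ℝ[X]) ^ d 0 • Nm := pencil_eq_X_pow_smul d S h0'
  set kC : Fin 3 → ℝ[X] := fun i => C (k i) with hkC
  set q₁ : ℝ[X] := kC ⬝ᵥ (Nm.adjugate *ᵥ kC) with hq₁
  set g : ℝ[X] := P.det with hg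
  set r : ℝ[X] := X ^ d 0 * (kC ⬝ᵥ (P.adjugate *ᵥ kC)) with hr
  -- `g = X^{3 d₀} · det N`, `r = X^{3 d₀} · q₁`
  have hg' : g = X ^ (3 * d 0) * Nm.det := by
    rw [hg, hPN, Matrix.det_smul, Fintype.card_fin, ← pow_mul, Nat.mul_comm]
  have hr' : r = X ^ (3 * d 0) * q₁ := by
    rw [hr, hPN, Matrix.adjugate_smul, Fintype.card_fin]
    show X ^ d 0 * (kC ⬝ᵥ ((((X : ℝ[X]) ^ d 0) ^ (3 - 1) • Nm.adjugate) *ᵥ kC)) = X ^ (3 * d 0) * q₁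
    rw [Matrix.smul_mulVec, dotProduct_smul, smul_eq_mul, hq₁, ← mul_assoc, ← pow_mul, ← pow_add]
    congr 2
    omega
  -- values at `0`: `(det N)(0) = det S₀ = 0`, `q₁(0) = kᵀ adj(S₀) k`
  have hN0 : (Polynomial.evalRingHom 0).mapMatrix Nm = S 0 := eval_zero_reduced_pencil d S h0
  have hdetN0 : (Nm.det).coeff 0 = 0 := by
    rw [Polynomial.coeff_zero_eq_eval_zero, ← Polynomial.coe_evalRingHom, RingHom.map_det, hN0, hdet]
  have hq0 : q₁.coeff 0 = k ⬝ᵥ ((S 0).adjugate *ᵥ k) := by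
    set φ : ℝ[X] →+* ℝ := Polynomial.evalRingHom 0 with hφ
    have hk' : (⇑φ ∘ kC) = k := by funext i; simp [hφ, hkC]
    have hmv : (⇑φ ∘ (Nm.adjugate *ᵥ kC)) = (φ.mapMatrix Nm).adjugate *ᵥ k := by
      funext i
      rw [Function.comp_apply, RingHom.map_mulVec, hk', ← RingHom.map_adjugate]
      rfl
    rw [Polynomial.coeff_zero_eq_eval_zero, ← Polynomial.coe_evalRingHom, ← hφ, hq₁, RingHom.map_dotProduct, hmv, hk',
      hN0]
  -- coefficient hypotheses of the lifting step at order `e = 3 d₀`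
  have hgcoeff : ∀ n ≤ 3 * d 0, g.coeff n = 0 := by
    intro n hn
    rw [hg']
    rcases Nat.lt_or_ge n (3 * d 0) with hlt | hge
    · exact Polynomial.coeff_X_pow_mul' _ _ _ |>.trans (if_neg (not_le.mpr hlt))
    · have heq : n = 3 * d 0 := le_antisymm hn hge
      rw [heq, Polynomial.coeff_X_pow_mul', if_pos le_rfl, Nat.sub_self, hdetN0]
  have hrcoeff : ∀ n < 3 * d 0, r.coeff n = 0 := by
    intro n hn
    rw [hr', Polynomial.coeff_X_pow_mul', if_neg (not_le.mpr hn)]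
  have hre : r.coeff (3 * d 0) ≠ 0 := by
    rw [hr', Polynomial.coeff_X_pow_mul', if_pos le_rfl, Nat.sub_self, hq0]; exact hk
  -- the lifting step
  have hs : s ≠ 0 := by
    intro h; have := hchain.2.2.2; rw [h, zero_mul] at this; exact lt_irrefl _ this
  obtain ⟨η₀, hη₀, H⟩ := altChain_lift_step g r (3 * d 0) hgcoeff hrcoeff hre N s a hchain
  obtain ⟨η, hη, hηb, hηs⟩ := exists_small_of_sign η₀ s (r.coeff (3 * d 0)) hη₀ hs hre
  obtain ⟨a', -, -, hchain'⟩ := H η hη hηb hηs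
  refine ⟨η, ?_⟩
  have hid : ((∑ l, (X : ℝ[X]) ^ d l • ((S l + if l = 0 then η • Matrix.vecMulVec k k else 0)).map C)).det
      = g + C η * r := by
    rw [det_pencil_perturb_rankOne, hg, hr]
  rw [hid]
  exact le_card_posRoots_of_altChain hchain'

/-- the perturbed letters stay symmetric. [folklore] -/
theorem perturb_rankOne_isSymm (S : Fin 4 → Matrix (Fin 3) (Fin 3) ℝ) (hS : ∀ l, (S l).IsSymm) (k : Fin 3 → ℝ) (η : ℝ)
    (l : Fin 4) : (S l + if l = 0 then η • Matrix.vecMulVec k k else 0).IsSymm := by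
  split_ifs
  · refine (hS l).add (Matrix.IsSymm.smul ?_ η)
    unfold Matrix.IsSymm
    ext i j
    simp [Matrix.vecMulVec_apply, mul_comm]
  · rw [add_zero]; exact hS l

/-- **DOOR-A READING (null-bottom chain-eighteens).**  On a support `d` with `d 0 < d l` (`l ≠ 0`) where the row
`PosRootLawOn 3 4 18 d` holds, NO real symmetric `(3,4)` pencil with singular bottom letter of adjugate rank (`det S 0 = 0`,
`kᵀ adj(S 0) k ≠ 0` for some `k`) carries an alternation chain of `19` positive points: it would lift to a nineteen on `d`.
The top-end version is this statement on the mirror support (`Census.posRootLawOn_iff_mirror_rev`). [folklore] -/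
theorem no_nullBottom_eighteen_of_posRootLawOn {d : Fin 4 → ℕ} (hd : PosRootLawOn 3 4 18 d) (h0 : ∀ l, l ≠ 0 → d 0 < d l)
    (S : Fin 4 → Matrix (Fin 3) (Fin 3) ℝ) (hS : ∀ l, (S l).IsSymm) (hdet : (S 0).det = 0)
    (k : Fin 3 → ℝ) (hk : k ⬝ᵥ ((S 0).adjugate *ᵥ k) ≠ 0) (s : ℝ) (a : Fin 19 → ℝ) :
    ¬ AltChain ((∑ l, (X : ℝ[X]) ^ d l • (S l).map C).det) 18 s a := by
  intro hchain
  obtain ⟨η, h19⟩ := nineteen_of_nullBottom_eighteen d h0 S hdet k hk hchain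
  have := hd (fun l => S l + if l = 0 then η • Matrix.vecMulVec k k else 0) (perturb_rankOne_isSymm S hS k η)
  omega

end Summit.ValiantsHypothesis.ValiantsHypothesis.Theorems.LacunarySymmetroidMatrixDescartes.Census
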